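import Summits.HubbardSuperconductivity.HubbardSuperconductivity.Theorems.KLProgrammeKLRegimeFlowReadScaleZeroSunsetCertRowsRecords
import Summits.HubbardSuperconductivity.HubbardSuperconductivity.Theorems.KLProgrammeKLRegimeFlowReadScaleZeroSunsetCertRowsFarSup

/-!
# Route `KLProgramme`, crux K3 — engine-flow child (stmt-HubbardSuperconductivity-20437), stub (C) at `n = 0`, located item #22a «(C)-SCALE0-PT2»:
# THE RECORD-LEVEL ONE-CALL ON THE FAR-SUP CERTIFICATE — `sunsetRows_of_records_farSup` (three records + a rational budget row ⇒ `hS0`/`hSk`)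

Seat hubbard-kl-k3c5-p1 (g15).  Twin of `…SunsetCertRowsRecords.sunsetRows_of_records` (p652962) on p1 g22's closer `…SunsetCertRowsFarSup.sunsetRows_of_certV3_farSup` (p660238),
i.e. the architecture of record after «ZONE-II-MAJORANT-DEAD» (pen (R255), KL STATUS 2026-08-28 18:58Z): near record `SunsetCellRecordV3` at the split radius `Rc` (= 1024; zone I only),
far Parseval-gap record `SunsetFarGapRecord {ω₁, G₀, G₂}` (p652354), and the far-SUP record `SunsetFarSupRecord {Sfar}` (p659068) booking the middle propagator at far separations by the
certified periodised sup `Sfar + 10⁻²⁹` instead of `50e^{−κ₁(Rc+1)} + ω₁(√G₀ + 10⁻¹⁰)` (×10³ at Rc = 1024).  Inputs: the three certificates, the regime, and ONLY closed rational side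
conditions on record fields (`4Rc+2 ≤ 2¹⁰·129²·(2²⁰+1)²`, `10⁻³⁰ ≤ Tmax`, `0 ≤ row k`, `1/32 ≤ ω₁ ≤ 1/4`, `255 ≤ ω₁(Rc+1)`, `0 ≤ G₂`, `G₀ ≤ s₀²`, `G₂ ≤ s₂²`, `0 ≤ s₀, s₂`, `0 ≤ Sfar`) +
the budget row `row k + (Sfar + 10⁻²⁹)·(2·10⁻⁸ + ω₁(t_k + 10⁻¹⁰)²) ≤ bS k` (`t = (s₀,(s₀+s₂)/2,s₂)`), every one `norm_num` on literals.  §1 `farBudget_le_rational_farSup` (the far budget's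
real-analysis part majorised by rationals, from `highShell_budget_le` + `sqrt_gapVec_le` of the Records file); §2 the call.
SIZES [float, this seat: gapsz j313657, kern3 j314164, kern2c j314221]: at Rc = 1024, ω₁ = 1/4: `G₂ ≤ 2·10⁴` (bound; truth ≈ 10⁴), `Sfar ≈ 3.5·10⁻⁵` ⇒ far row₂ ≈ 0.17 of `bS₂ = 1.0`
(≈ 0.02 with a two-low-shells frequency count — reserve); rows 0, 1 negligible.  Proof files only; the certificates are HYPOTHESES; nothing here asserts (C), any stub of 20437, K3,
the margin or superconductivity.  References: BGM 2006 §2.3–§2.4 [cite: BenfattoGiulianiMastropietro2006].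
-/

noncomputable section

namespace Summit.HubbardSuperconductivity.HubbardSuperconductivity.Theorems.KLRegimeSplit

set_option linter.dupNamespace false -- summit = problem name (single-conjunct summit), D-0017

open Literature.MathematicalPhysics.QuantumLattice Literature.Probability.LatticeModels Literature.Analysis.FunctionSpaces
open Summit.HubbardSuperconductivity.HubbardSuperconductivity.Theorems.DispersionFlow
open Summit.HubbardSuperconductivity.HubbardSuperconductivity.Theorems.EngineV8
open MeasureTheory Finset Complex UnitAddTorus Real

/-! ## §1 The far budget with the far-SUP constant -/
/-- **The far budget with the far-SUP constant**: for `klE0 ≤ ω₁ ≤ 1/4`, `255 ≤ ω₁(Rc+1)`, `0 ≤ S`, and square-root majorants `G₀ ≤ s₀²`, `0 ≤ G₂ ≤ s₂²`, `0 ≤ s₀, s₂`: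
`S·(2ᵏ·2500·C(ω₁,Rc,k)/ω₁ + ω₁(√G_k + 10⁻¹⁰)²) ≤ S·(2·10⁻⁸ + ω₁(t_k + 10⁻¹⁰)²)`, `t = (s₀, (s₀+s₂)/2, s₂)`. -/
theorem farBudget_le_rational_farSup {ω₁ : ℝ} (hω₁ : klE0 ≤ ω₁) (hω₁' : ω₁ ≤ 1 / 4) {Rc : ℕ} (hRc : 255 ≤ ω₁ * ((Rc : ℝ) + 1))
    {G₀ G₂ s₀ s₂ S : ℝ} (hG₂ : 0 ≤ G₂) (hs₀ : G₀ ≤ s₀ ^ 2) (hs₂ : G₂ ≤ s₂ ^ 2) (hs₀0 : 0 ≤ s₀) (hs₂0 : 0 ≤ s₂) (hS : 0 ≤ S)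
    (k : Fin 3) :
    S * (2 ^ (k : ℕ) * 2500 *
          ((max 1 ((2 * (k : ℕ) : ℝ) / Real.arsinh (ω₁ / 4))) ^ (k : ℕ) * Real.exp (-(Real.arsinh (ω₁ / 4) * (Rc + 1))) *
            (1 + 2 * (1 - Real.exp (-(Real.arsinh (ω₁ / 4) / 4)))⁻¹) ^ 2) / ω₁ +
          ω₁ * (Real.sqrt (![G₀, Real.sqrt (G₀ * G₂), G₂] k) + (10 : ℝ)⁻¹ ^ 10) ^ 2) ≤
      S * (2 * (10 : ℝ)⁻¹ ^ 8 + ω₁ * (![s₀, (s₀ + s₂) / 2, s₂] k + (10 : ℝ)⁻¹ ^ 10) ^ 2) := by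
  have hE0 : (1 : ℝ) / 32 ≤ ω₁ := by have : klE0 = 1 / 32 := rfl; rw [← this]; exact hω₁
  have hω0 : 0 ≤ ω₁ := by linarith
  have hH := highShell_budget_le hω₁ hω₁' hRc k
  have ht := sqrt_gapVec_le hG₂ hs₀ hs₂ hs₀0 hs₂0 k
  refine mul_le_mul_of_nonneg_left (add_le_add hH (mul_le_mul_of_nonneg_left ?_ hω0)) hS
  exact pow_le_pow_left₀ (by positivity) (by linarith [ht]) 2


/-! ## §2 The record-level one-call on the far-SUP certificate -/

section Records

open GrassmannAlgebra Matrix Set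
open scoped FourierTransform NNReal

variable {L M : ℕ} [NeZero L]

/-- **THE CERTIFIED SUNSET ROWS FROM THE THREE RECORDS** — `sunsetRows_of_certV3_farSup` (p1 g22) with the far-gap certificate read by `hgaps_of_farGapCert` and its budget
row replaced by the rational majorant of `farBudget_le_rational_farSup`.  Every side condition is a closed rational inequality on record fields (or on the emitted square-root
majorants `s₀, s₂`), decidable by `norm_num` at instantiation; the regime hypotheses are the engine's. -/
theorem sunsetRows_of_records_farSup [NeZero M] (c : SunsetCellRecordV3) (hc : ScaleZeroSunsetCertV3 c)
    (r : SunsetFarGapRecord) (hr : ScaleZeroFarGapCert c.toSunsetCellRecordV2 r)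
    (rs : SunsetFarSupRecord) (hrs : ScaleZeroFarSupCert c.toSunsetCellRecordV2 rs)
    {μ β U : ℝ} (hμ : μ ∈ klWindowC) (hμlo : (c.μlo : ℝ) ≤ μ) (hμhi : μ ≤ c.μhi)
    (hβ : klBetaMin ≤ β) (hU0 : 0 < U) (hU : U ≤ (2 : ℝ)⁻¹ ^ 20) (hL3 : klEngL₃ β U ≤ L) (hM3 : klEngM₃ β U L ≤ M)
    -- rational side conditions on the near record
    (hRc' : 4 * c.Rc + 2 ≤ 2 ^ 10 * 129 ^ 2 * (2 ^ 20 + 1) ^ 2)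
    (hTmax : (10 : ℚ)⁻¹ ^ 30 ≤ c.Tmax) (hrow : ∀ k : Fin 3, 0 ≤ c.row k)
    -- rational side conditions on the far records and the square-root majorants
    (hω₁ : (1 : ℚ) / 32 ≤ r.ω₁) (hω₁' : r.ω₁ ≤ 1 / 4) (hωRc : 255 ≤ r.ω₁ * ((c.Rc : ℚ) + 1)) (hG₂ : 0 ≤ r.G₂)
    {s₀ s₂ : ℚ} (hs₀ : r.G₀ ≤ s₀ ^ 2) (hs₂ : r.G₂ ≤ s₂ ^ 2) (hs₀0 : 0 ≤ s₀) (hs₂0 : 0 ≤ s₂) (hSfar : 0 ≤ rs.Sfar)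
    -- the budget row
    {bS : ℕ → ℝ}
    (hbS : ∀ k : Fin 3, (c.row k : ℝ) +
      ((rs.Sfar : ℝ) + (10 : ℝ)⁻¹ ^ 29) *
        (2 * (10 : ℝ)⁻¹ ^ 8 + (r.ω₁ : ℝ) * (![(s₀ : ℝ), ((s₀ : ℝ) + s₂) / 2, (s₂ : ℝ)] k + (10 : ℝ)⁻¹ ^ 10) ^ 2) ≤ bS k) :
    (∀ (σ : Fin 2) (p₀ : GridPoint L (2 * (2 * M))), ∑ p₁ : GridPoint L (2 * (2 * M)),
      (if p₁ = p₀ then (0 : ℝ) else (if p₁.2 - p₀.2 = 0 then (0 : ℝ) else 1) * ‖contr ℂ ((hubbardGridSub L M β (2 * (2 * M))).transpose * hubbardCovAboveCT L M β μ 0 0 klE0 *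
                hubbardGridSub L M β (2 * (2 * M))) (((p₁, σ), 0) : GridLeg (GridPoint L (2 * (2 * M)))) ((p₀, σ), 1) *
              (contr ℂ ((hubbardGridSub L M β (2 * (2 * M))).transpose * hubbardCovAboveCT L M β μ 0 0 klE0 *
                hubbardGridSub L M β (2 * (2 * M))) (((p₀, σ.rev), 0) : GridLeg (GridPoint L (2 * (2 * M)))) ((p₁, σ.rev), 1) *
                contr ℂ ((hubbardGridSub L M β (2 * (2 * M))).transpose * hubbardCovAboveCT L M β μ 0 0 klE0 *
                hubbardGridSub L M β (2 * (2 * M))) (((p₁, σ.rev), 0) : GridLeg (GridPoint L (2 * (2 * M)))) ((p₀, σ.rev), 1))‖) ≤ bS 0 * (((2 * (2 * M) : ℕ) : ℝ) / β)) ∧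
    (∀ k, 1 ≤ k → k ≤ 2 → ∀ (σ : Fin 2) (p₀ : GridPoint L (2 * (2 * M))), ∑ p₁ : GridPoint L (2 * (2 * M)),
      (if p₁ = p₀ then (0 : ℝ) else
        Real.sqrt ((((p₁.2 - p₀.2) 0).valMinAbs.natAbs : ℝ) ^ 2 + (((p₁.2 - p₀.2) 1).valMinAbs.natAbs : ℝ) ^ 2) ^ k * ‖contr ℂ ((hubbardGridSub L M β (2 * (2 * M))).transpose * hubbardCovAboveCT L M β μ 0 0 klE0 *
                hubbardGridSub L M β (2 * (2 * M))) (((p₁, σ), 0) : GridLeg (GridPoint L (2 * (2 * M)))) ((p₀, σ), 1) *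
              (contr ℂ ((hubbardGridSub L M β (2 * (2 * M))).transpose * hubbardCovAboveCT L M β μ 0 0 klE0 *
                hubbardGridSub L M β (2 * (2 * M))) (((p₀, σ.rev), 0) : GridLeg (GridPoint L (2 * (2 * M)))) ((p₁, σ.rev), 1) *
                contr ℂ ((hubbardGridSub L M β (2 * (2 * M))).transpose * hubbardCovAboveCT L M β μ 0 0 klE0 *
                hubbardGridSub L M β (2 * (2 * M))) (((p₁, σ.rev), 0) : GridLeg (GridPoint L (2 * (2 * M)))) ((p₀, σ.rev), 1))‖) ≤
        bS k * (((2 * (2 * M) : ℕ) : ℝ) / β)) := by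
  have hβ₀ : klBetaMin = 128 := rfl
  have hβpos : 0 < β := by rw [hβ₀] at hβ; linarith
  have hRcL : 4 * c.Rc + 2 ≤ L := le_trans hRc' ((klEngL₃_ge_of_le hβ hU0 hU).trans hL3)
  have hTmax' : (10 : ℝ)⁻¹ ^ 30 ≤ (c.Tmax : ℝ) := by
    have h := (Rat.cast_le (K := ℝ)).2 hTmax
    push_cast at h
    exact h
  have hrow' : ∀ k : Fin 3, 0 ≤ (c.row k : ℝ) := fun k => by exact_mod_cast hrow k
  have hω₁r : klE0 ≤ (r.ω₁ : ℝ) := by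
    have e : klE0 = 1 / 32 := rfl
    have h := (Rat.cast_le (K := ℝ)).2 hω₁
    push_cast at h
    rw [e]; exact h
  have hω₁r' : (r.ω₁ : ℝ) ≤ 1 / 4 := by
    have h := (Rat.cast_le (K := ℝ)).2 hω₁'
    push_cast at h
    exact h
  have hωRcr : (255 : ℝ) ≤ (r.ω₁ : ℝ) * ((c.Rc : ℝ) + 1) := by exact_mod_cast hωRc
  have hG₂r : (0 : ℝ) ≤ (r.G₂ : ℝ) := by exact_mod_cast hG₂
  have hs₀r : (r.G₀ : ℝ) ≤ (s₀ : ℝ) ^ 2 := by exact_mod_cast hs₀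
  have hs₂r : (r.G₂ : ℝ) ≤ (s₂ : ℝ) ^ 2 := by exact_mod_cast hs₂
  have hs₀0r : (0 : ℝ) ≤ (s₀ : ℝ) := by exact_mod_cast hs₀0
  have hs₂0r : (0 : ℝ) ≤ (s₂ : ℝ) := by exact_mod_cast hs₂0
  have hSfar' : (0 : ℝ) ≤ (rs.Sfar : ℝ) := by exact_mod_cast hSfar
  have hS : (0 : ℝ) ≤ (rs.Sfar : ℝ) + (10 : ℝ)⁻¹ ^ 29 := by positivity
  obtain ⟨hg0, hg2⟩ := hgaps_of_farGapCert (M := M) c.toSunsetCellRecordV2 r hr hβpos hμlo hμhi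
  refine sunsetRows_of_certV3_farSup (L := L) c hc hμ hμlo hμhi hβ hU0 hU hL3 hM3 hRcL hTmax' hrow' hω₁r rs hrs hSfar' hg0 hg2 (bS := bS) fun k => ?_
  have hfar := farBudget_le_rational_farSup hω₁r hω₁r' (Rc := c.Rc) hωRcr hG₂r hs₀r hs₂r hs₀0r hs₂0r hS k
  exact le_trans (add_le_add le_rfl hfar) (hbS k)

end Records

end Summit.HubbardSuperconductivity.HubbardSuperconductivity.Theorems.KLRegimeSplit

end
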